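import Literature.Analysis.FluidPDE.PlanarNoAnomalousDissipationForced
import Literature.Analysis.FluidPDE.PlanarNoAnomalousDissipationProofs
import HarnessLib

/-!
# Elgindi–Lopes Filho–Nussenzveig Lopes 2025: proved bookkeeping for the typed statements

Companion (theorems only, no definitions, no named facts) of `PlanarNoAnomalousDissipationForced.lean`
(arXiv:2504.18523v1, [`ElgindiLopesNussenzveig2025`]):

* the hypothesis classes are inhabited by the unforced, fixed-datum situation: a `ν`-independent `L²`
  datum converges strongly (`isStronglyConvergentData_const`), the zero force converges weakly with the
  uniform bound (`isWeaklyConvergentForcing_zero`);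
* hence Theorem 6.1 contains the unforced fixed-datum statement "`u₀ ∈ L²` divergence free with
  `curl u₀ ∈ L¹` ⇒ no anomalous dissipation for the Leray–Hopf family"
  (`ElgindiLopesNussenzveig2025_thm61.unforced_fixedDatum`) — the same conclusion the tree derives from
  De Rosa–Park's Thm. 1.4 (`DeRosaPark2024_thm14_T2.of_fixedDatum`): the two typed sources agree on
  their common special case;
* monotonicity of the uniform concentration functional (5.3) in the radius.

## References

* T. M. Elgindi, M. C. Lopes Filho, H. J. Nussenzveig Lopes, arXiv:2504.18523v1, Thm. 5.2 p. 13,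
  Thm. 6.1 and Remark 6.2 p. 17. [`ElgindiLopesNussenzveig2025`]
-/

open MeasureTheory Set Filter Topology Function Metric
open scoped ENNReal NNReal

namespace Literature.Analysis.FluidPDE

noncomputable section

open Literature.Analysis.FunctionSpaces DeRosaPark2024

namespace ELN2025

/-- A `ν`-independent `L²` datum satisfies H(a) (it converges to itself).
[cite: ElgindiLopesNussenzveig2025, Thm. 5.2 H(a) p. 13 (trivial instance)] -/
theorem isStronglyConvergentData_const {u₀ : UnitAddTorus (Fin 2) → EuclideanSpace ℝ (Fin 2)}
    (hu₀ : MemLp u₀ 2 volume) : IsStronglyConvergentData fun _ => u₀ := by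
  refine ⟨fun _ _ => hu₀, u₀, hu₀, ?_⟩
  simp

/-- The zero force satisfies H(b) (with limit `0` and bound `0`).
[cite: ElgindiLopesNussenzveig2025, Thm. 5.2 H(b) p. 13 (trivial instance)] -/
theorem isWeaklyConvergentForcing_zero (T : ℝ) :
    IsWeaklyConvergentForcing T (fun _ => (0 : ℝ → UnitAddTorus (Fin 2) → EuclideanSpace ℝ (Fin 2))) := by
  have hst : Torus.stLift (0 : ℝ → UnitAddTorus (Fin 2) → EuclideanSpace ℝ (Fin 2)) = 0 := by
    funext p
    simp [Torus.stLift]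
  refine ⟨fun _ _ => ?_, ⟨0, ENNReal.zero_lt_top, fun _ _ => ?_⟩, 0, ?_, ?_, fun g _ _ => ?_⟩
  · rw [hst]; exact aestronglyMeasurable_zero
  · simp
  · rw [hst]; exact aestronglyMeasurable_zero
  · simp
  · simp

/-- The uniform concentration functional (5.3) is monotone in the radius.
[cite: ElgindiLopesNussenzveig2025, Thm. 5.2 (5.3) p. 13] -/
theorem uniformVorticityConcentration_mono (T : ℝ) (ω : ℝ → ℝ → UnitAddTorus (Fin 2) → ℝ) :
    Monotone (uniformVorticityConcentration T ω) := by
  intro r r' hrr'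
  unfold uniformVorticityConcentration
  gcongr with ν _ t _ z

end ELN2025

open ELN2025

/-- **Theorem 6.1 contains the unforced fixed-datum statement**: from
`ElgindiLopesNussenzveig2025_thm61`, if `T > 0` and `u₀ ∈ L²(𝕋²)` is weakly divergence free with an
integrable weak curl `ω₀`, then every family `ν ↦ u ν` (`ν ∈ (0,1)`) of Leray–Hopf solutions of the
UNFORCED 2D Navier–Stokes equations with viscosity `ν` and the same datum `u₀` has
`ν∫₀ᵀ‖∇u^ν‖² → 0` as `ν ↓ 0` (Remark 6.2: such families exist). Same conclusion as
`DeRosaPark2024_thm14_T2.of_fixedDatum`. [cite: ElgindiLopesNussenzveig2025, Thm. 6.1 and Rmk. 6.2 p. 17] -/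
theorem ElgindiLopesNussenzveig2025_thm61.unforced_fixedDatum (h : ElgindiLopesNussenzveig2025_thm61)
    {T : ℝ} (hT : 0 < T) {u₀ : UnitAddTorus (Fin 2) → EuclideanSpace ℝ (Fin 2)}
    {ω₀ : UnitAddTorus (Fin 2) → ℝ} (hu₀ : MemLp u₀ 2 volume) (hdiv : Torus.IsWeaklyDivFree u₀)
    (hω₀ : Torus.HasWeakPlanarCurl u₀ ω₀)
    {u : ℝ → ℝ → UnitAddTorus (Fin 2) → EuclideanSpace ℝ (Fin 2)}
    (hu : ∀ ν ∈ Ioo (0 : ℝ) 1, Torus.IsLerayHopfOn T ν 0 u₀ (u ν)) :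
    NoAnomalousDissipation T u := by
  refine h T (fun _ => u₀) (fun _ => ω₀) (fun _ => 0) u (fun _ _ => 0) hT (fun _ _ => hdiv)
    (isStronglyConvergentData_const hu₀) (isWeaklyConvergentForcing_zero T) hu (fun _ _ => hω₀)
    (uniformIntegrable_const le_rfl ENNReal.one_ne_top (memLp_one_iff_integrable.2 hω₀.integrable))
    (fun _ _ => Eventually.of_forall fun _ => ?_) (Eventually.of_forall fun _ => ?_) ?_
  · simpa using Torus.hasWeakPlanarCurl_zero
  · exact uniformIntegrable_const le_rfl ENNReal.one_ne_top
      (memLp_one_iff_integrable.2 (integrable_zero _ _ _))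
  · simp

end

end Literature.Analysis.FluidPDE
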